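import Summits.NavierStokesRegularity.FluidComputer.GateBudgetLadderStepSwing
import Summits.NavierStokesRegularity.FluidComputer.GateBudgetDudHorizonSwing
import Summits.NavierStokesRegularity.FluidComputer.GateBudgetDudCeilingCorot
import HarnessLib

/-!
# GateBudget part 118 — the clean dud horizon as ONE object, bounded from both sides (§311–§314)

Cell `pub-fluidc`, blueprint seat bp1 (gen 40, SPEC-INPUT-bp1 §CM(4)(b): "one two-sided theorem
with a DEFINITION item"); namespace `Summit.NavierStokesRegularity.FluidComputer.GateBudget`,
headline member `RotorKnob.rotorCircuit K K¹⁰ ε ρ` of the two-scale family from `delayInit`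
(5.6), `K ≥ 16`, `ε² ≤ 1/(6K²⁰)`, UNIT LATTICE `ε = K¹⁰ρ²` (`k = 1`); modes `0 = a` (carrier),
`1 = b` (clock), `2 = c` (trigger), `3 = d` (transfer), `4 = ã` (output). HONEST FRAMING: a low
prior, high value-of-information experiment on Tao's machine paradigm; NOT a claim that NS blows up.

WHY. Until now the clean dud horizon had two halves living in two theorems about two different
things: SUFFICIENCY (part 108 §290: for every `N` in the log-free √-window, `N - 1 ≤ 0.0650K⁹`
at `K = 16`, the machine misfires cleanly `N` times — one rung at a time, by an inline induction)
and NECESSITY (part 116 §308: ANY pulse-separated run of clean normal-form ignitions with small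
pair has `N ≤ ΘK⁹/(7·1.83) + 1`). This file makes them two bounds on ONE defined quantity.
WHAT. §311 `run_of_step` (dependent choice along `ℕ`, pure logic) and `knob_ladder_run_swing`:
under part 107 §289's hypotheses the rungs form a SEQUENCE `(rₙ, θₙ)_{n<N}` with `SwingRung …
(n + 1) rₙ θₙ` and `r_{n+1} ≥ rₙ + 1` (part 117 §310 iterated from part 107's first rung). §312
`knob_clean_run_swing`: the member's clean run at `k = 1` — part 108 §290's conclusions, now for
ONE run: `rₙ > 1.8282 + (n + 1)`, `r_{n+1} ≥ rₙ + 1`, normal form with `5/4 ≤ θₙ ≤ 29/20`, `√P(rₙ)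
≤ 7/K⁴ + n·2/K⁹ + 141 log(n + 1)/(5K⁴)`, `P(rₙ) ≤ 1/50`, `n/K⁹ ≤ ã(rₙ) ≤ 0.1415`, `|d(rₙ)| ≤
7/K⁴`, for every `N ≥ 1` in the √-window. §313 DEFINITIONS: `IsCleanRun K ε ρ X Θ N r θ` — `N`
times `r₀ ≥ 0`, `r_{n+1} ≥ rₙ + 242/K⁹`, each a normal-form ignition `b(rₙ) = θₙε`, `5/4 ≤ θₙ ≤
Θ`, `c(rₙ) = ρ²/K⁹` with `d(rₙ)² + ã(rₙ)² ≤ 1/50` (EXACTLY part 116 §308's hypotheses); and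
`cleanHorizon K ε ρ X Θ := sSup {N | ∃ r θ, IsCleanRun K ε ρ X Θ N r θ}` — the length of the
longest clean run (`clean_run_length_le`: the set is bounded, so the `sSup` is attained).
§314 `knob_clean_horizon_two_sided` — THE CLEAN DUD HORIZON, TWO-SIDED: for the headline member,
`0.065K⁹ ≤ cleanHorizon K ε ρ X (29/20)` and `cleanHorizon K ε ρ X Θ ≤ ΘK⁹/(7·1.83) + 1` for
every `5/4 ≤ Θ ≤ 3/2` (`= 0.1132K⁹ + 1` at `Θ = 29/20`): the machine's own misfire ladder is a
clean run of `⌈0.065K⁹⌉` ignitions, and no clean run whatsoever is longer than `0.1132K⁹ + 1`.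
The two sides differ by the factor `1.74`; closing it is the `U = 2` vs `≈ 1.55a²/θ` slack of the
√P ledger (floor) against the `1.83` vs `1.90` rung leak (ceiling) — not attempted here.
HOW. §311 is `Nat.rec` + `Classical.choose` on part 117's step; §312 is part 108 §290's proof with
`knob_ladder_swing` replaced by §311 and the rung read out by `swingRung_readout`; §314's floor is
the log-free window at `N₀ = ⌈0.065K⁹⌉` (`log K ≤ (log 16/16)·K` by `Real.log_div_self_antitoneOn`,
`K³ ≥ 4096`, so `141·9 log K/(5K⁴) ≤ 0.0109` and `(N₀ - 1)·2/K⁹ ≤ 0.13`), its ceiling is part 116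
§308 verbatim; the two meet in `Nat.sSup_mem` / `le_csSup`.
HONEST LIMITS. (i) `k = 1` only (parts 100–117 are); (ii) `cleanHorizon` counts runs of clean
ignitions of the given trajectory `X` from ANY start `r₀ ≥ 0` — for the headline member the
lower bound is realised by the actual misfire ladder from `delayInit`, but the definition does
not single it out; (iii) existence per rung, no uniqueness — inherited; (iv) the gap `0.065`
vs `0.1132` is real slack, not rounding; (v) nothing about Navier–Stokes: these are inequalities
about Tao's five-mode toy circuit (5.5)/(5.6).
[cite: Tao2016AveragedNS, §5.5 Theorem 5.3, (5.5), (5.6), (b-eq), (c-eq), (d-eq), (ta-eq),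
(energy-con), (est)]
-/

noncomputable section

namespace Summit.NavierStokesRegularity.FluidComputer.GateBudget

open Real Set Filter Topology
open Literature.Analysis.FluidPDE.Tao2016AveragedNS

variable {K ε ρ : ℝ} {X : ℝ → Fin 5 → ℝ} {C : ℝ → ℝ}

/-! ## §311 Runs from steps -/

/-- §311 RUNS FROM STEPS (pure logic: dependent choice along `ℕ`). If `P 0 a` and every `x` with
`P n x` has a successor `y` with `P (n + 1) y` and `R x y`, then there is a sequence `f` with
`P n (f n)` and `R (f n) (f (n + 1))` for all `n` (`Nat.rec` on the subtypes `{x // P n x}` with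
`Classical.choose`). [folklore] -/
theorem run_of_step {α : Type*} {P : ℕ → α → Prop} {R : α → α → Prop} {a : α} (ha : P 0 a)
    (hstep : ∀ n x, P n x → ∃ y, P (n + 1) y ∧ R x y) :
    ∃ f : ℕ → α, (∀ n, P n (f n)) ∧ ∀ n, R (f n) (f (n + 1)) := by
  obtain ⟨F, hF⟩ : ∃ F : (n : ℕ) → {x : α // P n x} → {x : α // P (n + 1) x},
      ∀ n x, R x.1 (F n x).1 :=
    ⟨fun n x => ⟨Classical.choose (hstep n x.1 x.2), (Classical.choose_spec (hstep n x.1 x.2)).1⟩,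
      fun n x => (Classical.choose_spec (hstep n x.1 x.2)).2⟩
  obtain ⟨g, hg⟩ : ∃ g : (n : ℕ) → {x : α // P n x}, ∀ n, g (n + 1) = F n (g n) :=
    ⟨fun n => Nat.rec (motive := fun n => {x : α // P n x}) ⟨a, ha⟩ F n, fun _ => rfl⟩
  exact ⟨fun n => (g n).1, fun n => (g n).2, fun n => by simpa only [hg] using hF n (g n)⟩

/-- §311 THE READ-OUT OF A RUNG (part 107 §289's read-out, on the definition): under `K ≥ 16`,
the lattice data and `A₀ ≥ 0`, `D₀ + (1 + (10/9)K⁴)J ≤ D`, a rung of index `n ≥ 1` has `P(r) ≤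
1/50`, `0 ≤ ã(r) ≤ 0.1415` and `|d(r)| ≤ D`. [derived: part 117 §309, part 107 §289, part 79
(`ledger_invariant_final`), part 94 (`rung_numerics`)] -/
theorem swingRung_readout (hK : 16 ≤ K) (hε : 0 < ε) (hρ : 0 < ρ)
    (hlo : 200 * ε / K ^ 20 ≤ ρ ^ 2) (k : ℕ) (hk : ε = k * K ^ 10 * ρ ^ 2)
    {r₀ P₁ A₀ D₀ D U δ L : ℝ} (hA0 : 0 ≤ A₀)
    (hD : D₀ + (1 + 10 / 9 * K ^ 4) * ((61 / 12 * k + 2 / 3) / K ^ 10 + 3 / K ^ 9) ≤ D)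
    {n : ℕ} (hn : 1 ≤ n) {r θ : ℝ} (h : SwingRung K ε ρ X k r₀ P₁ A₀ D₀ U δ L n r θ) :
    X r 3 ^ 2 + X r 4 ^ 2 ≤ 1 / 50 ∧ 0 ≤ X r 4 ∧ X r 4 ≤ 1415 / 10000 ∧ |X r 3| ≤ D := by
  unfold SwingRung at h
  obtain ⟨-, -, -, -, -, -, hP50, hA, hd1, hd2, -⟩ := h
  obtain ⟨hk1, -, -, hδ0, -, -⟩ := rung_numerics hK hε hρ hlo k hk
  have hK0 : (0 : ℝ) < K := by linarith
  have hK9 : (0 : ℝ) < K ^ 9 := by positivity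
  have hn1 : (1 : ℝ) ≤ n := by exact_mod_cast hn
  have h310 : (0 : ℝ) ≤ 310 * log K / K ^ 9 :=
    div_nonneg (mul_nonneg (by norm_num) (Real.log_nonneg (by linarith))) hK9.le
  have hP : X r 3 ^ 2 + X r 4 ^ 2 ≤ 1 / 50 := by
    have h2 : (0 : ℝ) ≤ 6 / K ^ 9 := by positivity
    linarith only [hP50, hδ0, h310, h2]
  have ha0 : 0 ≤ X r 4 :=
    le_trans (add_nonneg hA0 (div_nonneg (by linarith only [hn1]) hK9.le)) hA
  have ha : X r 4 ≤ 1415 / 10000 := by nlinarith only [hP, ha0, sq_nonneg (X r 3)]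
  have e : ((n : ℝ) - 1) + 1 = n := by ring
  have hd : |X r 3| ≤ D :=
    (ledger_invariant_final hK0 (by positivity) (by linarith only [hn1]) hd1
      (by rw [e]; exact hd2)).trans hD
  exact ⟨hP, ha0, ha, hd⟩

/-- §311 **THE SWING LADDER AS A RUN** (part 107 §289's hypotheses VERBATIM, and `1 ≤ N`): there
are SEQUENCES `r θ : ℕ → ℝ` with `SwingRung … (n + 1) (r n) (θ n)` for every `n + 1 ≤ N` and
`r (n + 1) ≥ r n + 1` for every `n` — the first rung is part 107's (`n = 1`), each next one is
part 117 §310's step from the previous one (dependent choice, `run_of_step`); past the window the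
sequence is continued by `r + 1` (no claim there). [derived: part 117 §309–§310, this file §311] -/
theorem knob_ladder_run_swing
    (hX : ∀ t, HasDerivAt X (RotorKnob.rotorCircuit K (K ^ 10) ε ρ (X t)) t)
    (h0 : X 0 = delayInit) (hC : ∀ t, HasDerivAt C (X t 2) t) (hK : 16 ≤ K)
    (hε : 0 < ε) (hεK : ε ^ 2 ≤ 1 / (6 * K ^ 20)) (hρ : 0 < ρ)
    (hlo : 200 * ε / K ^ 20 ≤ ρ ^ 2) (hhi : K ^ 10 * ρ ^ 2 ≤ 2 * ε) (k : ℕ)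
    (hk : ε = k * K ^ 10 * ρ ^ 2) (hkone : k = 1) {r₀ θ₀ P₁ A₀ D₀ D U δ L : ℝ} {N : ℕ}
    (hr₀ : 0 ≤ r₀) (hb₀ : X r₀ 1 = θ₀ * ε) (hc₀ : X r₀ 2 = ρ ^ 2 / K ^ 9)
    (hP₁ : X r₀ 3 ^ 2 + X r₀ 4 ^ 2 ≤ P₁) (hθ₀lo : 139 / 100 - L ≤ θ₀) (hθ₀hi : θ₀ ≤ 29 / 20)
    (hL42 : L ≤ 42 / K ^ 9) (hN9 : (N : ℝ) - 1 ≤ K ^ 9)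
    (hA0 : 0 ≤ A₀) (hA₀ : A₀ ≤ X r₀ 4) (hD₀ : |X r₀ 3| ≤ D₀)
    (hD : D₀ + (1 + 10 / 9 * K ^ 4) * ((61 / 12 * k + 2 / 3) / K ^ 10 + 3 / K ^ 9) ≤ D)
    (hU : 157 / 100 + 1 / 3 + 333 / 100 * (D + D ^ 2) + 520 * log K * D ^ 2 ≤ U) (hU2 : 2 ≤ U)
    (hδ : (2 * D + (2 * k + 3) / (5 * K ^ 9)) * ((2 * k + 3) / (5 * K ^ 9))
      + 6 * (D + (2 * k + 3) / (5 * K ^ 9) + 3 / K ^ 9) / K ^ 9 ≤ δ)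
    (hL : 242 * log K / K ^ 10 + 37 * (D + (2 * k + 3) / (5 * K ^ 9) + 4 / K ^ 9) / K ^ 9 ≤ L)
    (hNW : (√P₁ + ((N : ℝ) - 1) * (U / K ^ 9) + δ * K ^ 9 / 2 * log N) ^ 2
      + (3 * (k * π / ((25 / 16 - 1 / 10 ^ 6) * K ^ 10 - 1) + 1 / K ^ 19
      + 310 * log K / K ^ 9) / 10 + 6 / K ^ 9) + δ ≤ 1 / 50)
    (hNpos : 1 ≤ N) :
    ∃ r θ : ℕ → ℝ,
      (∀ n : ℕ, n + 1 ≤ N → SwingRung K ε ρ X k r₀ P₁ A₀ D₀ U δ L (n + 1) (r n) (θ n)) ∧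
      ∀ n : ℕ, r n + 1 ≤ r (n + 1) := by
  obtain ⟨r₁, θ₁, h1⟩ := knob_ladder_swing_rung hX h0 hC hK hε hεK hρ hlo hhi k hk hkone hr₀ hb₀
    hc₀ hP₁ hθ₀lo hθ₀hi hL42 hN9 hA0 hA₀ hD₀ hD hU hU2 hδ hL hNW 1 le_rfl hNpos
  have hstep : ∀ (n : ℕ) (p : ℝ × ℝ),
      (n + 1 ≤ N → SwingRung K ε ρ X k r₀ P₁ A₀ D₀ U δ L (n + 1) p.1 p.2) → ∃ q : ℝ × ℝ,
        (n + 1 + 1 ≤ N → SwingRung K ε ρ X k r₀ P₁ A₀ D₀ U δ L (n + 1 + 1) q.1 q.2) ∧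
          p.1 + 1 ≤ q.1 := by
    intro n p hp
    by_cases h : n + 2 ≤ N
    · obtain ⟨r', θ', hsep, hrung⟩ := knob_ladder_step_swing hX h0 hC hK hε hεK hρ hlo hhi k hk
        hkone hr₀ hP₁ hL42 hN9 hA0 hD₀ hD hU hU2 hδ hL hNW (m := n + 1) (by omega) (by omega)
        (hp (by omega))
      exact ⟨(r', θ'), fun _ => hrung, hsep⟩
    · exact ⟨(p.1 + 1, p.2), fun h' => absurd h' (by omega), le_rfl⟩
  obtain ⟨f, hf, hR⟩ := run_of_step
    (P := fun (n : ℕ) (p : ℝ × ℝ) =>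
      n + 1 ≤ N → SwingRung K ε ρ X k r₀ P₁ A₀ D₀ U δ L (n + 1) p.1 p.2)
    (R := fun p q : ℝ × ℝ => p.1 + 1 ≤ q.1) (a := (r₁, θ₁)) (fun _ => h1) hstep
  exact ⟨fun n => (f n).1, fun n => (f n).2, fun n hn => hf n hn, fun n => hR n⟩

/-! ## §312 The member's clean run at k = 1 -/

/-- §312 **THE CLEAN RUN OF THE HEADLINE MEMBER, k = 1** (from `delayInit` with a trigger
primitive `C`, `K ≥ 16`, `0 < ε`, `ε² ≤ 1/(6K²⁰)`, `0 < ρ`, `ε = kK¹⁰ρ²` with `k = 1`; `1 ≤ N`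
in the √-window `(N - 1)·2/K⁹ + (14k + 127) log N/(5K⁴) ≤ 0.1409`): there is ONE run `(rₙ,
θₙ)_{n<N}` of normal-form ignitions — `rₙ > 1.8282 + (n + 1)`, `r_{n+1} ≥ rₙ + 1`, `b(rₙ) = θₙε`
with `5/4 ≤ θₙ ≤ 29/20`, `c(rₙ) = ρ²/K⁹`, `√P(rₙ) ≤ 7/K⁴ + n·2/K⁹ + (14k + 127) log(n + 1)/(5K⁴)`,
`P(rₙ) ≤ 1/50`, `n/K⁹ ≤ ã(rₙ) ≤ 0.1415`, `|d(rₙ)| ≤ 7/K⁴` — part 108 §290's rungs, in one climb.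
[derived: this file §311, part 108 §290 (plumbing verbatim) and §290a, part 83 §241–§242, part
96 §271, part 85 §250, part 89 §258, part 106 §288a] -/
theorem knob_clean_run_swing
    (hX : ∀ t, HasDerivAt X (RotorKnob.rotorCircuit K (K ^ 10) ε ρ (X t)) t)
    (h0 : X 0 = delayInit) (hC : ∀ t, HasDerivAt C (X t 2) t) (hK : 16 ≤ K)
    (hε : 0 < ε) (hεK : ε ^ 2 ≤ 1 / (6 * K ^ 20)) (hρ : 0 < ρ) (k : ℕ)
    (hk : ε = k * K ^ 10 * ρ ^ 2) (hkone : k = 1) (N : ℕ) (hNpos : 1 ≤ N)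
    (hNW : ((N : ℝ) - 1) * (2 / K ^ 9) + (14 * k + 127) / (5 * K ^ 4) * log N ≤ 1409 / 10000) :
    ∃ r θ : ℕ → ℝ, (∀ n : ℕ, r n + 1 ≤ r (n + 1)) ∧ ∀ n : ℕ, n + 1 ≤ N →
      18282 / 10000 + ((n : ℝ) + 1) < r n ∧ X (r n) 1 = θ n * ε ∧
      5 / 4 ≤ θ n ∧ θ n ≤ 29 / 20 ∧ X (r n) 2 = ρ ^ 2 / K ^ 9 ∧
      √(X (r n) 3 ^ 2 + X (r n) 4 ^ 2)
        ≤ 7 / K ^ 4 + (n : ℝ) * (2 / K ^ 9) + (14 * k + 127) / (5 * K ^ 4) * log ((n : ℝ) + 1) ∧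
      X (r n) 3 ^ 2 + X (r n) 4 ^ 2 ≤ 1 / 50 ∧
      (n : ℝ) / K ^ 9 ≤ X (r n) 4 ∧ X (r n) 4 ≤ 1415 / 10000 ∧ |X (r n) 3| ≤ 7 / K ^ 4 := by
  have hkR : (k : ℝ) = 1 := by exact_mod_cast hkone
  have hlat : ε = K ^ 10 * ρ ^ 2 := by rw [hk, hkR, one_mul]
  obtain ⟨hlo, hhi, -, -, -, -, -⟩ := unit_lattice_numerics hK hlat
  have hkK : (k : ℝ) ≤ K ^ 2 := by rw [hkR]; nlinarith only [hK]
  obtain ⟨r₁, θ₁, hr1, hb1, hθlo, hθhi, hc1, he0, hP1, hd1, hk1⟩ :=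
    knob_ladder_anchor_member hX h0 hC hK hε hεK hρ hlo hhi k hk
  obtain ⟨hD, -, -, -, hres⟩ := two_sided_numerics hK hk1 hkK
  have hU := swing_ledger_numerics hK
  have hS := clock_slip_numerics hK hk1 hkK
  obtain ⟨hL0, hL42⟩ := sharp_loss_numerics hK hk1 hkK
  obtain ⟨hcL, hwin⟩ := pair_ledger_numerics hK hk1 hkK
  have hK0 : (0 : ℝ) < K := by linarith
  have hK4 : (0 : ℝ) < K ^ 4 := by positivity
  have hK9 : (0 : ℝ) < K ^ 9 := by positivity
  have hk0 : (0 : ℝ) ≤ k := Nat.cast_nonneg k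
  obtain ⟨e₁, he₁_def⟩ : ∃ e₁ : ℝ,
      e₁ = k * π / (49 / 100 * K ^ 10 - 1) + 2 / K ^ 10 + 245 / K ^ 8 := ⟨_, rfl⟩
  obtain ⟨δ₀, hδ₀_def⟩ : ∃ δ₀ : ℝ,
      δ₀ = (2 * (7 / K ^ 4) + (2 * k + 3) / (5 * K ^ 9)) * ((2 * k + 3) / (5 * K ^ 9))
        + 6 * (7 / K ^ 4 + (2 * k + 3) / (5 * K ^ 9) + 3 / K ^ 9) / K ^ 9 := ⟨_, rfl⟩
  obtain ⟨u, hu_def⟩ : ∃ u : ℝ, u = 2 / K ^ 9 := ⟨_, rfl⟩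
  obtain ⟨cM, hcM_def⟩ : ∃ cM : ℝ, cM = (14 * k + 127) / (5 * K ^ 4) := ⟨_, rfl⟩
  rw [← he₁_def] at hP1 hd1 hD hres
  rw [← hδ₀_def] at hcL
  have he₁0 : 0 ≤ e₁ := (abs_nonneg _).trans hd1
  have hsq₁ : √(e₁ ^ 2) = e₁ := Real.sqrt_sq he₁0
  have he₁7 : e₁ ≤ 7 / K ^ 4 := by
    have hJ : 0 ≤ (1 + 10 / 9 * K ^ 4) * ((61 / 12 * k + 2 / 3) / K ^ 10 + 3 / K ^ 9) := by
      positivity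
    linarith only [hD, hJ]
  have hu0 : 0 ≤ u := by rw [hu_def]; positivity
  have hδ₀0 : 0 ≤ δ₀ := by rw [hδ₀_def]; positivity
  have hδS : δ₀ ≤ (11 / 10 + k ^ 2 / 10) / K ^ 9 := by
    have h0 : 0 ≤ (2829 / 10000 + (7 / 2 + k ^ 2 / 3 + 1 / 1000) / K ^ 9)
        * ((7 / 2 + k ^ 2 / 3 + 1 / 1000) / K ^ 9) := by positivity
    rw [hδ₀_def]; linarith only [hS, h0]
  have hcM0 : 0 ≤ cM := by rw [hcM_def]; positivity
  have hθ₀lo : 139 / 100 - (242 * log K / K ^ 10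
        + 37 * (7 / K ^ 4 + (2 * k + 3) / (5 * K ^ 9) + 4 / K ^ 9) / K ^ 9) ≤ θ₁ := by
    linarith only [hL0, hθlo]
  simp only [← hu_def, ← hcM_def] at hNW hcL ⊢
  have hN1 : (1 : ℝ) ≤ N := by exact_mod_cast hNpos
  have hlogN : 0 ≤ log (N : ℝ) := Real.log_nonneg hN1
  have hcMN : 0 ≤ cM * log N := mul_nonneg hcM0 hlogN
  -- `N - 1 ≤ K⁹` from the √-window: `2(N - 1) ≤ 0.1409K⁹`
  have hN9 : (N : ℝ) - 1 ≤ K ^ 9 := by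
    have h : ((N : ℝ) - 1) * u ≤ 1409 / 10000 := by linarith only [hNW, hcMN]
    rw [hu_def, ← mul_div_assoc, div_le_iff₀ hK9] at h
    linarith only [h, hK9.le]
  -- the √-window of part 97 §272 from the closed-form one (part 96 §271)
  have hcLN : δ₀ * K ^ 9 / 2 * log N ≤ cM * log N := mul_le_mul_of_nonneg_right hcL hlogN
  have hW0 : 0 ≤ √(e₁ ^ 2) + ((N : ℝ) - 1) * u + δ₀ * K ^ 9 / 2 * log N := by
    rw [hsq₁]
    have h1 : 0 ≤ ((N : ℝ) - 1) * u := mul_nonneg (by linarith only [hN1]) hu0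
    have h2 : 0 ≤ δ₀ * K ^ 9 / 2 * log N := mul_nonneg (by positivity) hlogN
    linarith only [he₁0, h1, h2]
  have hWle : √(e₁ ^ 2) + ((N : ℝ) - 1) * u + δ₀ * K ^ 9 / 2 * log N
      ≤ 7 / K ^ 4 + 1409 / 10000 := by
    rw [hsq₁]; linarith only [he₁7, hNW, hcLN]
  have hW2 := pow_le_pow_left₀ hW0 hWle 2
  have hNW' : (√(e₁ ^ 2) + ((N : ℝ) - 1) * u + δ₀ * K ^ 9 / 2 * log N) ^ 2
      + (3 * (k * π / ((25 / 16 - 1 / 10 ^ 6) * K ^ 10 - 1) + 1 / K ^ 19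
        + 310 * log K / K ^ 9) / 10 + 6 / K ^ 9) + δ₀ ≤ 1 / 50 := by
    nlinarith only [hW2, hres, sq_nonneg e₁, hδS, hwin]
  obtain ⟨r, θ, hrun, hsep⟩ := knob_ladder_run_swing hX h0 hC hK hε hεK hρ hlo hhi k hk hkone
    (le_of_lt (by linarith only [hr1])) hb1 hc1 hP1 hθ₀lo (by linarith only [hθhi]) hL42 hN9
    le_rfl he0 hd1 hD hU le_rfl (le_of_eq hδ₀_def.symm) le_rfl (by rw [← hu_def]; exact hNW')
    hNpos
  refine ⟨r, θ, hsep, fun n hn => ?_⟩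
  have hR := hrun n hn
  obtain ⟨hP, -, ha, hd⟩ := swingRung_readout (X := X) hK hε hρ hlo k hk le_rfl hD (by omega) hR
  unfold SwingRung at hR
  have en : ((n + 1 : ℕ) : ℝ) = n + 1 := Nat.cast_succ n
  have en1 : (n : ℝ) + 1 - 1 = n := by ring
  rw [en, en1] at hR
  obtain ⟨hr, hb, hθ1, hθ2, hc, hW, -, hA, -, -, -⟩ := hR
  have hn0 : (0 : ℝ) ≤ n := Nat.cast_nonneg n
  have hlogn : 0 ≤ log ((n : ℝ) + 1) := Real.log_nonneg (by linarith only [hn0])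
  have hcLn : δ₀ * K ^ 9 / 2 * log ((n : ℝ) + 1) ≤ cM * log ((n : ℝ) + 1) :=
    mul_le_mul_of_nonneg_right hcL hlogn
  refine ⟨by linarith only [hr, hr1], hb, hθ1, hθ2, hc, ?_, hP, by simpa using hA, ha, hd⟩
  rw [hsq₁, ← hu_def] at hW
  linarith only [hW, he₁7, hcLn]

/-! ## §313 Clean runs and the clean horizon (DEFINITIONS) -/

/-- §313 A CLEAN RUN OF `N` IGNITIONS with clock ceiling `Θ` (a DEFINITION; trajectory `X`,
lattice data `K, ε, ρ`, times `r : ℕ → ℝ`, clock amplitudes `θ : ℕ → ℝ`, only the indices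
`n < N` matter): `r 0 ≥ 0`; consecutive ignitions a pulse apart, `r (n + 1) ≥ r n + 242/K⁹`;
and each `r n` a normal-form ignition `b(r n) = θ n · ε`, `5/4 ≤ θ n ≤ Θ`, `c(r n) = ρ²/K⁹`
whose output pair is small, `d(r n)² + ã(r n)² ≤ 1/50` — EXACTLY the hypotheses of part 116
§308 (and of part 72 §219). [derived: part 116 §308 (hypotheses only)] -/
def IsCleanRun (K ε ρ : ℝ) (X : ℝ → Fin 5 → ℝ) (Θ : ℝ) (N : ℕ) (r θ : ℕ → ℝ) : Prop :=
  0 ≤ r 0 ∧ (∀ n : ℕ, n + 1 < N → r n + 242 / K ^ 9 ≤ r (n + 1)) ∧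
    ∀ n : ℕ, n < N → (5 / 4 ≤ θ n ∧ θ n ≤ Θ) ∧ X (r n) 1 = θ n * ε ∧
      X (r n) 2 = ρ ^ 2 / K ^ 9 ∧ X (r n) 3 ^ 2 + X (r n) 4 ^ 2 ≤ 1 / 50

/-- §313 THE CLEAN HORIZON (a DEFINITION): the supremum over the lengths `N` of clean runs with
clock ceiling `Θ` of the trajectory `X` — a natural number (`sSup` in `ℕ`; the empty run has
length `0`, and whenever the lengths are bounded, as `clean_run_length_le` shows for the members,
the supremum is the length of a longest clean run, `Nat.sSup_mem`). [derived: this file §313] -/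
def cleanHorizon (K ε ρ : ℝ) (X : ℝ → Fin 5 → ℝ) (Θ : ℝ) : ℕ :=
  sSup {N : ℕ | ∃ r θ : ℕ → ℝ, IsCleanRun K ε ρ X Θ N r θ}

/-- §313 The empty run is clean. [derived: this file §313] -/
theorem isCleanRun_zero (K ε ρ : ℝ) (X : ℝ → Fin 5 → ℝ) (Θ : ℝ) :
    IsCleanRun K ε ρ X Θ 0 (fun _ => 0) (fun _ => 0) :=
  ⟨le_rfl, fun n h => absurd h (by omega), fun n h => absurd h (Nat.not_lt_zero n)⟩

/-- §313 THE CEILING FOR CLEAN RUNS = part 116 §308 read through the definition: for the headline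
member (`K ≥ 16`, `ε² ≤ 1/(6K²⁰)`, unit lattice) every clean run with clock ceiling `5/4 ≤ Θ ≤
3/2` has `N ≤ ΘK⁹/(7·1.83) + 1`. [derived: part 116 §308] -/
theorem clean_run_length_le
    (hX : ∀ t, HasDerivAt X (RotorKnob.rotorCircuit K (K ^ 10) ε ρ (X t)) t)
    (h0 : X 0 = delayInit) (hC : ∀ t, HasDerivAt C (X t 2) t) (hK : 16 ≤ K) (hε : 0 < ε)
    (hεK : ε ^ 2 ≤ 1 / (6 * K ^ 20)) (hρ : 0 < ρ) (hlat : ε = K ^ 10 * ρ ^ 2) {Θ : ℝ}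
    (hΘ1 : 5 / 4 ≤ Θ) (hΘ2 : Θ ≤ 3 / 2) {N : ℕ} {r θ : ℕ → ℝ}
    (h : IsCleanRun K ε ρ X Θ N r θ) : (N : ℝ) ≤ Θ * K ^ 9 / (7 * (183 / 100)) + 1 := by
  obtain ⟨hr0, hsep, hall⟩ := h
  exact knob_dud_ceiling_corot hX h0 hC hK hε hεK hρ hlat hΘ1 hΘ2 hr0 hsep
    (fun n hn => (hall n hn).1) (fun n hn => (hall n hn).2.1) (fun n hn => (hall n hn).2.2.1)
    (fun n hn => (hall n hn).2.2.2)

/-! ## §314 The clean dud horizon, two-sided -/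

/-- §314 **THE CLEAN DUD HORIZON OF TAO'S MACHINE, TWO-SIDED** (headline member
`rotorCircuit K K¹⁰ ε ρ` from `delayInit` with a trigger primitive `C`, `K ≥ 16`, `0 < ε`, `ε² ≤
1/(6K²⁰)`, `0 < ρ`, UNIT LATTICE `ε = K¹⁰ρ²`):
`0.065·K⁹ ≤ cleanHorizon K ε ρ X (29/20)` and `cleanHorizon K ε ρ X Θ ≤ ΘK⁹/(7·1.83) + 1` for every
`5/4 ≤ Θ ≤ 3/2` — the machine misfires cleanly at least `0.065K⁹` times in a row (its own ladder,
§312 at `N₀ = ⌈0.065K⁹⌉`, inside the log-free √-window since `141·9 log K/(5K⁴) ≤ 0.0109`), and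
no clean run of this trajectory, wherever it starts, is longer than `0.1132K⁹ + 1` (`Θ = 29/20`;
part 116 §308). One object, two bounds, a factor `1.74` apart. [derived: this file §312–§313,
part 116 §308, part 106 §288a; `Real.log_div_self_antitoneOn`, `Nat.sSup_mem`, `le_csSup`] -/
theorem knob_clean_horizon_two_sided
    (hX : ∀ t, HasDerivAt X (RotorKnob.rotorCircuit K (K ^ 10) ε ρ (X t)) t)
    (h0 : X 0 = delayInit) (hC : ∀ t, HasDerivAt C (X t 2) t) (hK : 16 ≤ K) (hε : 0 < ε)
    (hεK : ε ^ 2 ≤ 1 / (6 * K ^ 20)) (hρ : 0 < ρ) (hlat : ε = K ^ 10 * ρ ^ 2) :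
    65 / 1000 * K ^ 9 ≤ (cleanHorizon K ε ρ X (29 / 20) : ℝ) ∧
      ∀ Θ : ℝ, 5 / 4 ≤ Θ → Θ ≤ 3 / 2 →
        (cleanHorizon K ε ρ X Θ : ℝ) ≤ Θ * K ^ 9 / (7 * (183 / 100)) + 1 := by
  have hK0 : (0 : ℝ) < K := by linarith
  have hK9 : (0 : ℝ) < K ^ 9 := by positivity
  -- the lengths of clean runs: a nonempty set of naturals, bounded by part 116 §308
  have hbdd : ∀ Θ : ℝ, 5 / 4 ≤ Θ → Θ ≤ 3 / 2 →
      BddAbove {N : ℕ | ∃ r θ : ℕ → ℝ, IsCleanRun K ε ρ X Θ N r θ} := by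
    intro Θ hΘ1 hΘ2
    refine ⟨⌊Θ * K ^ 9 / (7 * (183 / 100)) + 1⌋₊, fun N hN => ?_⟩
    obtain ⟨r, θ, h⟩ := hN
    exact Nat.le_floor (clean_run_length_le hX h0 hC hK hε hεK hρ hlat hΘ1 hΘ2 h)
  have hne : ∀ Θ : ℝ, ({N : ℕ | ∃ r θ : ℕ → ℝ, IsCleanRun K ε ρ X Θ N r θ} : Set ℕ).Nonempty :=
    fun Θ => ⟨0, fun _ => 0, fun _ => 0, isCleanRun_zero K ε ρ X Θ⟩
  refine ⟨?_, fun Θ hΘ1 hΘ2 => ?_⟩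
  swap
  · obtain ⟨r, θ, h⟩ := Nat.sSup_mem (hne Θ) (hbdd Θ hΘ1 hΘ2)
    exact clean_run_length_le hX h0 hC hK hε hεK hρ hlat hΘ1 hΘ2 h
  -- the floor: `N₀ = ⌈0.065K⁹⌉` clean misfires from `delayInit`, §312 in the log-free √-window
  obtain ⟨N₀, hN₀_def⟩ : ∃ N₀ : ℕ, N₀ = ⌈65 / 1000 * K ^ 9⌉₊ := ⟨_, rfl⟩
  have hc0 : (0 : ℝ) ≤ 65 / 1000 * K ^ 9 := by positivity
  have hN₀le : 65 / 1000 * K ^ 9 ≤ (N₀ : ℝ) := by rw [hN₀_def]; exact Nat.le_ceil _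
  have hN₀lt : (N₀ : ℝ) < 65 / 1000 * K ^ 9 + 1 := by rw [hN₀_def]; exact Nat.ceil_lt_add_one hc0
  have hK9big : (68719476736 : ℝ) ≤ K ^ 9 := by
    have := pow_le_pow_left₀ (by norm_num : (0 : ℝ) ≤ 16) hK 9; norm_num at this; exact this
  have hN₀posR : (0 : ℝ) < N₀ := by linarith only [hN₀le, hK9big]
  have hN₀pos : 1 ≤ N₀ := Nat.succ_le_of_lt (by exact_mod_cast hN₀posR)
  -- `log K ≤ (log 16/16)·K` (`Real.log_div_self_antitoneOn`, as part 74 §251) and `K³ ≥ 4096`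
  have he16 : exp 1 ≤ 16 := by have := Real.exp_one_lt_d9; linarith
  have hmono := Real.log_div_self_antitoneOn (show (16 : ℝ) ∈ Set.Ici (exp 1) from he16)
    (show K ∈ Set.Ici (exp 1) from le_trans he16 hK) hK
  simp only at hmono
  have hlog16 : log 16 ≤ 2773 / 1000 := by
    have e : log (16 : ℝ) = 4 * log 2 := by
      rw [show (16 : ℝ) = 2 ^ 4 by norm_num, Real.log_pow]; norm_num
    rw [e]; linarith only [Real.log_two_lt_d9]
  have hl : log K ≤ 2773 / 16000 * K := by
    rw [div_le_iff₀ hK0] at hmono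
    have := mul_le_mul_of_nonneg_right (div_le_div_of_nonneg_right hlog16 (by norm_num :
      (0 : ℝ) ≤ 16)) hK0.le
    linarith only [hmono, this]
  have hK3 : (4096 : ℝ) ≤ K ^ 3 := by
    have := pow_le_pow_left₀ (by norm_num : (0 : ℝ) ≤ 16) hK 3; norm_num at this; exact this
  have hlogt : 141 / (5 * K ^ 4) * (9 * log K) ≤ 109 / 10000 := by
    rw [div_mul_eq_mul_div, div_le_iff₀ (by positivity)]
    have h2 : 1269 * (2773 / 16000) ≤ 109 / 10000 * 5 * K ^ 3 := by linarith only [hK3]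
    calc 141 * (9 * log K) ≤ 1269 * (2773 / 16000) * K := by linarith only [hl]
      _ ≤ 109 / 10000 * 5 * K ^ 3 * K := mul_le_mul_of_nonneg_right h2 hK0.le
      _ = 109 / 10000 * (5 * K ^ 4) := by ring
  have hN₀K : (N₀ : ℝ) ≤ K ^ 9 := by linarith only [hN₀lt, hK9big]
  have hlogN : log (N₀ : ℝ) ≤ 9 * log K := by
    have h := Real.log_le_log hN₀posR hN₀K
    have h9 : log (K ^ 9) = 9 * log K := by rw [Real.log_pow]; norm_num
    linarith only [h, h9]
  have hwin : ((N₀ : ℝ) - 1) * (2 / K ^ 9) + (14 * ((1 : ℕ) : ℝ) + 127) / (5 * K ^ 4) * log N₀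
      ≤ 1409 / 10000 := by
    have e1 : (14 * ((1 : ℕ) : ℝ) + 127) / (5 * K ^ 4) = 141 / (5 * K ^ 4) := by norm_num
    have hcM0 : (0 : ℝ) ≤ 141 / (5 * K ^ 4) := by positivity
    have h1 : ((N₀ : ℝ) - 1) * (2 / K ^ 9) ≤ 13 / 100 := by
      have h := mul_le_mul_of_nonneg_right
        (le_of_lt (by linarith only [hN₀lt] : (N₀ : ℝ) - 1 < 65 / 1000 * K ^ 9))
        (by positivity : (0 : ℝ) ≤ 2 / K ^ 9)
      have e : 65 / 1000 * K ^ 9 * (2 / K ^ 9) = 13 / 100 := by field_simp; ring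
      linarith only [h, e]
    have h2 := mul_le_mul_of_nonneg_left hlogN hcM0
    rw [e1]; linarith only [h1, h2, hlogt]
  obtain ⟨-, -, hk1, -, -, -, -⟩ := unit_lattice_numerics hK hlat
  obtain ⟨r, θ, hsep, hrun⟩ := knob_clean_run_swing hX h0 hC hK hε hεK hρ 1 hk1 rfl N₀ hN₀pos hwin
  have h242 : 242 / K ^ 9 ≤ (1 : ℝ) := by rw [div_le_one hK9]; linarith only [hK9big]
  have hmem : N₀ ∈ {N : ℕ | ∃ r θ : ℕ → ℝ, IsCleanRun K ε ρ X (29 / 20) N r θ} := by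
    refine ⟨r, θ, ?_, fun n hn => ?_, fun n hn => ?_⟩
    · obtain ⟨h, -⟩ := hrun 0 hN₀pos
      push_cast at h; linarith only [h]
    · linarith only [hsep n, h242]
    · obtain ⟨-, hb, hθ1, hθ2, hc, -, hP, -, -, -⟩ := hrun n hn
      exact ⟨⟨hθ1, hθ2⟩, hb, hc, hP⟩
  have hle := le_csSup (hbdd (29 / 20) (by norm_num) (by norm_num)) hmem
  calc 65 / 1000 * K ^ 9 ≤ (N₀ : ℝ) := hN₀le
    _ ≤ (cleanHorizon K ε ρ X (29 / 20) : ℝ) := by exact_mod_cast hle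

end Summit.NavierStokesRegularity.FluidComputer.GateBudget

end
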